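import Literature.IUT.LogVolume.PilotDivisorsArchThreshold
import Literature.IUT.LogVolume.GenuineLogTheta
import Mathlib.Tactic.FieldSimp
import Mathlib.Tactic.Ring
import Mathlib.Tactic.Linarith
import HarnessLib

/-!
# The archimedean threshold at the DEFINED numbers of a genuine Θ-volume input: the hull slack Cor. 3.12 needs

PROOF-ONLY addendum (theorems, no definitions; abc-iut cell, seat abc-iut-w5-d030 gen 9) to abc-iut-w5-d241's
`PilotDivisorsArchThreshold` (the comparison `−deĝ̲(P_q) ≤ −deĝ̲_lgp(P_Θ) + 𝔼_j (j+1)·c` holds iff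
`deĝ̲(𝔮) ≤ 6·l·(l+5)·c/((l+4)(l−3))`) and abc-iut-S2's `GenuineLogTheta` (the DEFINED numbers of [IUTchIII] Cor. 3.12
for a genuine input `I`: `archLogTheta l = ((l+5)/4)·log π` — [IUTchIV] Thm. 1.10 Step (vii), kurims Apr-2020
manuscript p. 30: "The resulting “procession-normalized upper bound” is given by `((l+5)/4)·log(π)`" —, the `Prop`s
`Cor312Of I : −|log(q)| ≤ −|log(Θ)|` and `HullEstimateOf I δ : negLogThetaNonarch I ≤ −deĝ̲_lgp(P_Θ) + δ`, and the
bookkeeping `gap_le_of_cor312Of_of_hullEstimateOf : deĝ̲_lgp(P_Θ) − deĝ̲(P_q) ≤ δ + archLogTheta l`).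

What is proved (classical real arithmetic; nothing disputed is used or asserted):
* `archLogTheta_eq_processionNormalized` — S2's closed form IS L6's procession-normalisation of `i ↦ (i+2)·log π`
  ([IUTchIII] Prop. 3.9 (i); `|S^±_{j+1}| = j+1`, `j = i+1`), so `neg_ndeg_qPilot_le_archLogTheta_iff` restates the
  threshold with `archLogTheta l` on the left;
* **`gap_le_add_archLogTheta_iff`** — with a slack `δ`: `deĝ̲_lgp(P_Θ) − deĝ̲(P_q) ≤ δ + ((l+5)/4)·log π` iff
  `((l+4)(l−3)/(24l))·deĝ̲(𝔮) − ((l+5)/4)·log π ≤ δ` — the procession-normalised log-volume the (Ind1)/(Ind2)/(Ind3)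
  hull must contribute ABOVE the regions' own nonarchimedean volume `−deĝ̲_lgp(P_Θ)`, in closed form
  (`gap_le_add_archLogTheta_iff_ndeg_le`: equivalently `deĝ̲(𝔮) ≤ 24·l·(δ + ((l+5)/4)·log π)/((l+4)(l−3))`, the shape of
  the height bound of [IUTchIV] Thm. 1.10);
* for a genuine input `I`: **`ThetaVolumeInput.hullSlack_le_of_cor312Of_of_hullEstimateOf`** (Cor. 3.12 for `I` AND a
  hull estimate with slack `δ` force `((l+4)(l−3)/(24l))·deĝ̲(𝔮) − ((l+5)/4)·log π ≤ δ`),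
  `ThetaVolumeInput.ndeg_qDivisor_le_of_cor312Of_of_hullEstimateOf`, and the contrapositive
  **`ThetaVolumeInput.not_cor312Of_of_hullEstimateOf_of_lt`**: a hull estimate with slack
  `δ < ((l+4)(l−3)/(24l))·deĝ̲(𝔮) − ((l+5)/4)·log π` REFUTES `Cor312Of I`; in particular
  (`not_cor312Of_of_hullEstimateOf_zero`) a SHARP hull estimate (`δ = 0`: the hull adds no nonarchimedean volume)
  refutes `Cor312Of I` for every input with `deĝ̲(𝔮) > (50/3)·log π`.

[cite: Mochizuki2012, IUTchIV Thm. 1.10 Step (vii) p. 30, Step (viii) p. 30–31] [cite: DupuyHilado2025, §3.3, §1 (1.1)]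
HONEST FRAMING: `Cor312Of`/`HullEstimateOf` are `Prop`s of the tree, never asserted here; the theorems are implications
between them and one real inequality; no side taken on [IUTchIII] Cor. 3.12; nothing here asserts abc proved or refuted.
-/

noncomputable section

namespace Literature.IUT.LogVolume

open Literature.IUT.LogThetaLattice (processionNormalized)

namespace PilotData

variable {F : Type*} [Field F] [NumberField F] (X : PilotData F)

/-- **`archLogTheta l = ((l+5)/4)·log π` IS the procession-normalised family `i ↦ (i+2)·log π`** (`|S^±_{j+1}| = j+1`
factors of `π` in the Step (vii) container `π^{j+1}·B_I`, `j = i+1`; abc-iut-w5-d241's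
`processionNormalized_natCast_add_two_mul`). [cite: Mochizuki2012, IUTchIV Thm. 1.10 Step (vii) p. 30] -/
theorem archLogTheta_eq_processionNormalized :
    ThetaVolumeInput.archLogTheta X.l =
      processionNormalized (fun i : Fin X.lstar => (((i : ℕ) : ℝ) + 2) * Real.log Real.pi) := by
  rw [processionNormalized_natCast_add_two_mul, ThetaVolumeInput.archLogTheta]

/-- The threshold with S2's closed form on the left: `−deĝ̲(P_q) ≤ −deĝ̲_lgp(P_Θ) + archLogTheta l` iff
`deĝ̲(𝔮) ≤ 6·l·(l+5)·log π/((l+4)(l−3))`. [cite: Mochizuki2012, IUTchIV Thm. 1.10 Step (vii) p. 30]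
[cite: DupuyHilado2025, §3.3] -/
theorem neg_ndeg_qPilot_le_archLogTheta_iff :
    -FinDivisor.ndeg F X.qPilot ≤ -LgpDivisor.ndegLgp X.thetaPilot + ThetaVolumeInput.archLogTheta X.l ↔
      FinDivisor.ndeg F X.qDivisor ≤
        6 * X.l * ((X.l : ℝ) + 5) * Real.log Real.pi / (((X.l : ℝ) + 4) * ((X.l : ℝ) - 3)) := by
  rw [archLogTheta_eq_processionNormalized, neg_ndeg_qPilot_le_iff]

/-- **The hull slack in closed form.** With a slack `δ`: `deĝ̲_lgp(P_Θ) − deĝ̲(P_q) ≤ δ + ((l+5)/4)·log π` iff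
`((l+4)(l−3)/(24l))·deĝ̲(𝔮) − ((l+5)/4)·log π ≤ δ`. [cite: DupuyHilado2025, §3.3]
[cite: Mochizuki2012, IUTchIV Thm. 1.10 Step (vii) p. 30] -/
theorem gap_le_add_archLogTheta_iff (δ : ℝ) :
    LgpDivisor.ndegLgp X.thetaPilot - FinDivisor.ndeg F X.qPilot ≤ δ + ThetaVolumeInput.archLogTheta X.l ↔
      ((X.l : ℝ) + 4) * ((X.l : ℝ) - 3) / (24 * X.l) * FinDivisor.ndeg F X.qDivisor -
          ((X.l : ℝ) + 5) / 4 * Real.log Real.pi ≤ δ := by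
  rw [ndegLgp_thetaPilot_sub_ndeg_qPilot, ThetaVolumeInput.archLogTheta]
  constructor
  · intro h
    linarith
  · intro h
    linarith

/-- … equivalently, solved for the Tate-divisor degree: `deĝ̲(𝔮) ≤ 24·l·(δ + ((l+5)/4)·log π)/((l+4)(l−3))` — the
shape of the height bound of [IUTchIV] Thm. 1.10 (Step (viii): sum the local bounds, compare with `−|log(q)|`).
[cite: Mochizuki2012, IUTchIV Thm. 1.10 Step (viii) p. 30–31] [cite: DupuyHilado2025, §3.3] -/
theorem gap_le_add_archLogTheta_iff_ndeg_le (δ : ℝ) :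
    LgpDivisor.ndegLgp X.thetaPilot - FinDivisor.ndeg F X.qPilot ≤ δ + ThetaVolumeInput.archLogTheta X.l ↔
      FinDivisor.ndeg F X.qDivisor ≤
        24 * (X.l : ℝ) * (δ + ((X.l : ℝ) + 5) / 4 * Real.log Real.pi) / (((X.l : ℝ) + 4) * ((X.l : ℝ) - 3)) := by
  have hden := X.lFactor_pos
  have hl := X.l_cast_pos
  have h24 : (0 : ℝ) < 24 * X.l := by linarith
  rw [gap_le_add_archLogTheta_iff, le_div_iff₀ hden, sub_le_iff_le_add, div_mul_eq_mul_div, div_le_iff₀ h24]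
  constructor
  · intro h
    nlinarith [h]
  · intro h
    nlinarith [h]

end PilotData

namespace ThetaVolumeInput

variable {F₀ : Type} [Field F₀] [NumberField F₀] {K : Type} [Field K] [NumberField K] [Algebra F₀ K]
  (I : ThetaVolumeInput F₀ K)

/-- **Cor. 3.12 for the input AND a hull estimate with slack `δ` force
`((l+4)(l−3)/(24l))·deĝ̲(𝔮) − ((l+5)/4)·log π ≤ δ`**: the hull must contribute at least that much procession-normalised
log-volume above the regions' own (`gap_le_of_cor312Of_of_hullEstimateOf` in closed form). Two `Prop`s of the tree as
hypotheses; nothing asserted. [cite: Mochizuki2012, IUTchIV Thm. 1.10 Step (viii) p. 30–31] [cite: DupuyHilado2025, §1 (1.1)] -/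
theorem hullSlack_le_of_cor312Of_of_hullEstimateOf {δ : ℝ} (h1 : I.Cor312Of) (h2 : I.HullEstimateOf δ) :
    ((I.X.l : ℝ) + 4) * ((I.X.l : ℝ) - 3) / (24 * I.X.l) * FinDivisor.ndeg F₀ I.X.qDivisor -
        ((I.X.l : ℝ) + 5) / 4 * Real.log Real.pi ≤ δ :=
  (I.X.gap_le_add_archLogTheta_iff δ).1 (I.gap_le_of_cor312Of_of_hullEstimateOf h1 h2)

/-- … hence `log(q) = deĝ̲(𝔮) ≤ 24·l·(δ + ((l+5)/4)·log π)/((l+4)(l−3))`.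
[cite: Mochizuki2012, IUTchIV Thm. 1.10 Step (viii) p. 30–31] -/
theorem ndeg_qDivisor_le_of_cor312Of_of_hullEstimateOf {δ : ℝ} (h1 : I.Cor312Of) (h2 : I.HullEstimateOf δ) :
    FinDivisor.ndeg F₀ I.X.qDivisor ≤
      24 * (I.X.l : ℝ) * (δ + ((I.X.l : ℝ) + 5) / 4 * Real.log Real.pi) /
        (((I.X.l : ℝ) + 4) * ((I.X.l : ℝ) - 3)) :=
  (I.X.gap_le_add_archLogTheta_iff_ndeg_le δ).1 (I.gap_le_of_cor312Of_of_hullEstimateOf h1 h2)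

/-- **Contrapositive: a hull estimate with slack below the needed amount REFUTES `Cor312Of I`.** If
`HullEstimateOf I δ` with `δ < ((l+4)(l−3)/(24l))·deĝ̲(𝔮) − ((l+5)/4)·log π`, then `¬ Cor312Of I`. An implication between
the tree's `Prop`s; no side taken. [cite: Mochizuki2012, IUTchIV Thm. 1.10 Step (viii) p. 30–31] [cite: DupuyHilado2025, §1 (1.1)] -/
theorem not_cor312Of_of_hullEstimateOf_of_lt {δ : ℝ} (h2 : I.HullEstimateOf δ)
    (hδ : δ < ((I.X.l : ℝ) + 4) * ((I.X.l : ℝ) - 3) / (24 * I.X.l) * FinDivisor.ndeg F₀ I.X.qDivisor -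
        ((I.X.l : ℝ) + 5) / 4 * Real.log Real.pi) :
    ¬ I.Cor312Of := fun h1 =>
  absurd (I.hullSlack_le_of_cor312Of_of_hullEstimateOf h1 h2) (not_le.mpr hδ)

/-- **The sharp case `δ = 0`** (the hull adds no nonarchimedean volume above the regions' own `−deĝ̲_lgp(P_Θ)` — the
situation of the cell's fourth-corner certificate before any indeterminacy is paid): then `Cor312Of I` FAILS for every
input with `deĝ̲(𝔮) > (50/3)·log π` (abc-iut-w5-d241's envelope `threshold_mul_le`), at every prime `l ≥ 5`.
[cite: Mochizuki2012, IUTchIV Thm. 1.10 Step (vii) p. 30] [cite: DupuyHilado2025, §3.3] -/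
theorem not_cor312Of_of_hullEstimateOf_zero (h2 : I.HullEstimateOf 0)
    (hq : 50 / 3 * Real.log Real.pi < FinDivisor.ndeg F₀ I.X.qDivisor) : ¬ I.Cor312Of := by
  intro h1
  have h := I.ndeg_qDivisor_le_of_cor312Of_of_hullEstimateOf h1 h2
  rw [zero_add, show 24 * (I.X.l : ℝ) * (((I.X.l : ℝ) + 5) / 4 * Real.log Real.pi) =
    6 * I.X.l * ((I.X.l : ℝ) + 5) * Real.log Real.pi by ring] at h
  have hpi : (0 : ℝ) ≤ Real.log Real.pi := (Real.log_pos (by linarith [Real.pi_gt_three])).le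
  exact absurd (h.trans (I.X.threshold_mul_le hpi)) (not_le.mpr hq)

/-- Conversely, in the sharp case the comparison `Cor312Of I` HOLDS whenever `deĝ̲(𝔮) ≤ 6·log π`, PROVIDED the
nonarchimedean part of `−|log(Θ)|` is at least the regions' own `−deĝ̲_lgp(P_Θ)` (the trivial direction of the hull,
hypothesis `hle`). [cite: Mochizuki2012, IUTchIV Thm. 1.10 Step (vii) p. 30] [cite: DupuyHilado2025, §3.3] -/
theorem cor312Of_of_le (hle : -LgpDivisor.ndegLgp I.X.thetaPilot ≤ I.negLogThetaNonarch)
    (hq : FinDivisor.ndeg F₀ I.X.qDivisor ≤ 6 * Real.log Real.pi) : I.Cor312Of := by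
  have hpi : (0 : ℝ) ≤ Real.log Real.pi := (Real.log_pos (by linarith [Real.pi_gt_three])).le
  have h := (I.X.neg_ndeg_qPilot_le_archLogTheta_iff).2 (hq.trans (I.X.six_mul_le_threshold_mul hpi))
  unfold Cor312Of negLogTheta negAbsLogQ
  linarith

end ThetaVolumeInput

end Literature.IUT.LogVolume

end
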